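import Summits.BirchSwinnertonDyer.BirchSwinnertonDyer.Theorems.CMKolyvaginAtInertTwoCMKolyvaginConjectureAtInertTwoAllShallowGenusDescent
import HarnessLib

/-!
# Crux `CMKolyvaginConjectureAtInertTwo` (stmt-BirchSwinnertonDyer-24648), open stub `stub_positiveDepth`:
# ON H₂, AT EVERY SQUARE-FREE CM-INERT KOLYVAGIN LEVEL (DEEP OR SHALLOW), A HALF OF THE GENUS TRACE IS AUTOMATICALLY
# NEGATED BY EVERY `σ_ℓ` — the witness habitat is uniformly the genus-character part `E(L_n)^{χ_n}`

Route `CMKolyvaginAtInertTwo` (cell `pub/bsd-eis`, seat `leafhand-bsd-cmkolyvaginatinert-2` g0); helper (`--supports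
stmt-BirchSwinnertonDyer-24648 --as helper`). THEOREMS ONLY (no definition, no named fact, no `sorry`); closes nothing;
BSD is proved for no curve. Sequel (and simplification on H₂) of this seat's `…ShallowGenusDescent` (p800829) and
`…AllShallowGenusDescent` (p801497).

WHAT. Those two files descend a half `Q` of the genus point ∕ genus trace `G` (`2Q = G`) to the `⟨σ_ℓ²⟩`-fixed points by
AVERAGING over `H_n`, which needs `|H_n|` odd (all `ℓ ≡ 1 (mod 4)`), and then get `σ_ℓ Q = −Q` from `E(K[n])[2] = 0`. On H₂
(`2` inert in `F`, `ρ̄_{E,2}` onto) the second step alone suffices at EVERY level: since `σ_ℓ G = −G` (p801497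
`pointGalHom_σ_genusTrace_eq_neg`) and `E(K[n])[2] = 0` (p801497 `twoTorsion_eq_zero_of_cmInert_squarefree`), ANY half `Q` of
`G` has `2(σ_ℓ Q + Q) = 0`, so `σ_ℓ Q = −Q` and hence `σ_ℓ² Q = Q`, for every `ℓ ∣ n`, with NO parity condition on `ℓ`:

* `pointGalHom_σ_eq_neg_of_two_smul_eq_genusTrace` — any `Q` with `2Q = G` satisfies `σ_ℓ Q = −Q` (`ℓ ∣ n`);
* `pointGalHom_σ_sq_eq_of_two_smul_eq_genusTrace` — hence `σ_ℓ² Q = Q`;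
* **`two_dvd_derivedPoint_iff_exists_forall_anti`** — on an H₂ frame, at EVERY square-free level `n` whose prime factors are
  Zhang–Kolyvagin primes at `2` inert in `F`, for any datum: `P(n) ∈ 2E(K[n]) ⟺ ∃ Q, (∀ ℓ ∣ n, σ_ℓ² Q = Q ∧ σ_ℓ Q = −Q) ∧ 2Q = G`.
  So the habitat of a witness is UNIFORM in the depth: a half of the genus trace in `E(L_n)` (`L_n = K[n]^{⟨σ_ℓ² : ℓ∣n⟩}`, the
  genus `2`-layer, `Gal(L_n/K[1]) ≃ (ℤ/2)^{ν(n)}`) on which every `σ_ℓ` acts by `−1` — the `χ_n`-part for the ONE character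
  `χ_n` with `χ_n(σ_ℓ) = −1` (`ℓ ∣ n`), i.e. a `K[1]`-point of one quadratic twist of `E`. Depth enters ONLY through `M(n)`
  (Kolyvagin's `2^M`-descent) and the BSD-consistency constraint p799717 (deep levels are `2`-divisible on `Σ ≥ 2` frames);
  p800829 ∕ p801497 remain the versions WITHOUT the H₂ torsion hypotheses (odd-order averaging).

HONEST FRAMING: a two-line consequence of landed theorems; the twist identification `E(L_n)^{χ_n} ≃ E^{(χ_n)}(K[1])` is NOT
formalised; no stub is closed; BSD is proved for no curve.
[cite: GrossLMS1991, §3 (3.5), Prop. 3.7 (1), §4 (4.1), Lemma 4.3] [cite: WZhang2014, §3.7] [cite: Cox2013, §9.A]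
-/

set_option linter.dupNamespace false -- `Summit.BirchSwinnertonDyer.BirchSwinnertonDyer.Theorems.…` (summit = sub)
set_option autoImplicit false

noncomputable section

open scoped Classical

namespace Summit.BirchSwinnertonDyer.BirchSwinnertonDyer.Theorems.CMKolyvaginConjecturePositiveDepth

open Finset WeierstrassCurve NumberField Literature.NumberTheory.EllipticCurves
  Literature.NumberTheory.EllipticCurves.ModularForms Literature.NumberTheory.EllipticCurves.Rank1Residual
  Summit.BirchSwinnertonDyer.BirchSwinnertonDyer.Theorems

variable {K : Type} [Field K] [NumberField K]

/-- **Any half of the genus trace is negated by every `σ_ℓ`** (`ℓ ∣ n`) on an H₂ frame (`W/ℚ` globally minimal with CM, `2`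
inert in `F`, `ρ̄_{E,2}` onto; `K` with odd `d_K ≠ −3` and Heegner for `N_E`; `n` square-free with CM-inert Zhang–Kolyvagin prime
factors): if `2Q = G = Σ_{s∈S} s(𝒩_n y(n))` then `σ_ℓ Q = −Q`, because `2(σ_ℓ Q + Q) = σ_ℓ G + G = 0` and `E(K[n])[2] = 0`.
[cite: GrossLMS1991, §3 Prop. 3.7 (1), §4 (4.1), Lemma 4.3] -/
theorem pointGalHom_σ_eq_neg_of_two_smul_eq_genusTrace (W : WeierstrassCurve ℚ) [W.IsElliptic]
    [W.IsGloballyMinimal] [NeZero (W.conductorNorm ℤ)] (hCM : W.HasCM) (hin : CMInert W 2)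
    (hρ : W.HasSurjectiveModNGaloisRep (2 : ℤ)) (hK : IsImaginaryQuadratic K)
    (hodd : Odd (NumberField.discr K)) (h3 : NumberField.discr K ≠ -3)
    (hH : SatisfiesHeegnerHypothesis (W.conductorNorm ℤ) K)
    {Dt : ModularParametrizationData W (W.conductorNorm ℤ)} {β : ℤ} {ι : K →+* ℂ} {n : ℕ} (hn : Squarefree n)
    (hKol : ∀ ℓ ∈ n.primeFactors, Zhang2014.IsKolyvaginPrime (W.conductorNorm ℤ) W K 2 ℓ ∧ CMInert W ℓ)
    (d : KolyvaginHeegnerData Dt β ι n) {Q : (W.baseChange (ringClassField K ι n)).toAffine.Point}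
    (hQ : (2 : ℤ) • Q = ∑ s ∈ d.S, pointGalHom W (ringClassField K ι n) s
      (n.primeFactorsList.foldr
        (fun q x ↦ ∑ k ∈ range ((q + 1) / 2), pointGalHom W (ringClassField K ι n) ((d.σ q ^ 2) ^ k) x) d.y))
    {ℓ : ℕ} (hℓn : ℓ ∈ n.primeFactors) :
    pointGalHom W (ringClassField K ι n) (d.σ ℓ) Q = -Q := by
  have hg := pointGalHom_σ_genusTrace_eq_neg W hCM hK hodd h3 hH hn hKol d hℓn
  have h2 : (2 : ℤ) • (pointGalHom W (ringClassField K ι n) (d.σ ℓ) Q + Q) = 0 := by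
    rw [smul_add, ← map_zsmul, hQ, hg, neg_add_cancel]
  exact eq_neg_of_add_eq_zero_left
    (twoTorsion_eq_zero_of_cmInert_squarefree W hCM hin hρ hK ι hH hn (fun q hq ↦ (hKol q hq).2) _ h2)

/-- **Hence any half of the genus trace is fixed by every `σ_ℓ²`** (`ℓ ∣ n`), same H₂ frame: `σ_ℓ² Q = σ_ℓ(−Q) = Q`.
[cite: GrossLMS1991, §4 (4.1), Lemma 4.3] -/
theorem pointGalHom_σ_sq_eq_of_two_smul_eq_genusTrace (W : WeierstrassCurve ℚ) [W.IsElliptic]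
    [W.IsGloballyMinimal] [NeZero (W.conductorNorm ℤ)] (hCM : W.HasCM) (hin : CMInert W 2)
    (hρ : W.HasSurjectiveModNGaloisRep (2 : ℤ)) (hK : IsImaginaryQuadratic K)
    (hodd : Odd (NumberField.discr K)) (h3 : NumberField.discr K ≠ -3)
    (hH : SatisfiesHeegnerHypothesis (W.conductorNorm ℤ) K)
    {Dt : ModularParametrizationData W (W.conductorNorm ℤ)} {β : ℤ} {ι : K →+* ℂ} {n : ℕ} (hn : Squarefree n)
    (hKol : ∀ ℓ ∈ n.primeFactors, Zhang2014.IsKolyvaginPrime (W.conductorNorm ℤ) W K 2 ℓ ∧ CMInert W ℓ)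
    (d : KolyvaginHeegnerData Dt β ι n) {Q : (W.baseChange (ringClassField K ι n)).toAffine.Point}
    (hQ : (2 : ℤ) • Q = ∑ s ∈ d.S, pointGalHom W (ringClassField K ι n) s
      (n.primeFactorsList.foldr
        (fun q x ↦ ∑ k ∈ range ((q + 1) / 2), pointGalHom W (ringClassField K ι n) ((d.σ q ^ 2) ^ k) x) d.y))
    {ℓ : ℕ} (hℓn : ℓ ∈ n.primeFactors) :
    pointGalHom W (ringClassField K ι n) (d.σ ℓ ^ 2) Q = Q := by
  have h1 := pointGalHom_σ_eq_neg_of_two_smul_eq_genusTrace W hCM hin hρ hK hodd h3 hH hn hKol d hQ hℓn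
  rw [pow_two, map_mul]
  change pointGalHom W (ringClassField K ι n) (d.σ ℓ) (pointGalHom W (ringClassField K ι n) (d.σ ℓ) Q) = Q
  rw [h1, map_neg, h1, neg_neg]

/-- **THE WITNESS HABITAT IS UNIFORM IN THE DEPTH (H₂).** Frame: `W/ℚ` globally minimal with CM, `2` inert in `F`, `ρ̄_{E,2}`
onto; `K` imaginary quadratic with odd `d_K ≠ −3` and Heegner for `N_E`; `n` square-free, every prime factor a Zhang–Kolyvagin
prime at `2` inert in `F` (ANY depth `M(ℓ)`); any datum `d`. With `G = Σ_{s∈S} s(𝒩_n y(n))` the genus trace: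
**`P(n) ∈ 2E(K[n]) ⟺ ∃ Q, (∀ ℓ ∣ n, σ_ℓ² Q = Q ∧ σ_ℓ Q = −Q) ∧ 2Q = G`** (p795141's genus-trace form; every half of `G` is
automatically of this kind). The all-shallow hypothesis of p801497's `two_dvd_derivedPoint_iff_exists_forall_anti_of_allShallow`
is thus unnecessary on H₂. [cite: GrossLMS1991, §3 (3.5), Prop. 3.7 (1), §4 (4.1), Lemma 4.3] [cite: WZhang2014, §3.7] -/
theorem two_dvd_derivedPoint_iff_exists_forall_anti (W : WeierstrassCurve ℚ) [W.IsElliptic]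
    [W.IsGloballyMinimal] [NeZero (W.conductorNorm ℤ)] (hCM : W.HasCM) (hin : CMInert W 2)
    (hρ : W.HasSurjectiveModNGaloisRep (2 : ℤ)) (hK : IsImaginaryQuadratic K)
    (hodd : Odd (NumberField.discr K)) (h3 : NumberField.discr K ≠ -3)
    (hH : SatisfiesHeegnerHypothesis (W.conductorNorm ℤ) K)
    {Dt : ModularParametrizationData W (W.conductorNorm ℤ)} {β : ℤ} {ι : K →+* ℂ} {n : ℕ} (hn : Squarefree n)
    (hKol : ∀ ℓ ∈ n.primeFactors, Zhang2014.IsKolyvaginPrime (W.conductorNorm ℤ) W K 2 ℓ ∧ CMInert W ℓ)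
    (d : KolyvaginHeegnerData Dt β ι n) :
    (∃ Q : (W.baseChange (ringClassField K ι n)).toAffine.Point, (2 : ℤ) • Q = d.derivedPoint) ↔
      ∃ Q : (W.baseChange (ringClassField K ι n)).toAffine.Point,
        (∀ ℓ ∈ n.primeFactors, pointGalHom W (ringClassField K ι n) (d.σ ℓ ^ 2) Q = Q ∧
          pointGalHom W (ringClassField K ι n) (d.σ ℓ) Q = -Q) ∧ (2 : ℤ) • Q =
          ∑ s ∈ d.S, pointGalHom W (ringClassField K ι n) s
            (n.primeFactorsList.foldr
              (fun q x ↦ ∑ k ∈ range ((q + 1) / 2), pointGalHom W (ringClassField K ι n) ((d.σ q ^ 2) ^ k) x) d.y) := by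
  rw [two_dvd_derivedPoint_iff_two_dvd_genusTrace W hCM hK hodd h3 hH hn hKol d]
  refine ⟨fun ⟨Q, hQ⟩ ↦ ⟨Q, fun ℓ hℓ ↦ ⟨?_, ?_⟩, hQ⟩, fun ⟨Q, _, hQ⟩ ↦ ⟨Q, hQ⟩⟩
  · exact pointGalHom_σ_sq_eq_of_two_smul_eq_genusTrace W hCM hin hρ hK hodd h3 hH hn hKol d hQ hℓ
  · exact pointGalHom_σ_eq_neg_of_two_smul_eq_genusTrace W hCM hin hρ hK hodd h3 hH hn hKol d hQ hℓ

end Summit.BirchSwinnertonDyer.BirchSwinnertonDyer.Theorems.CMKolyvaginConjecturePositiveDepth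

end
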